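import Literature.Computability.Complexity.BranchingProgramEntropy
import Summits.PneNP.PneNP.Theorems.SzkEntropyPeaThreeNotInPSocketRawDefs
import Literature.Computability.Complexity.PEADegreeReduction
import HarnessLib

/-!
# Route SzkEntropy, crux `PeaThreeNotInP` (stmt-PneNP-10776), line `SketchIdeator3`, socket rider:
# the raw ↔ typed bridge

The raw-data functions of `SzkEntropyPeaThreeNotInPSocketRawDefs.lean` (what the socket's `CodeFP`
stubs compute) ARE the untyped images of the tree's AIK degree-3 encoding of the COMPILED programs
of `Literature/Computability/Complexity/BranchingProgramEntropy.lean`: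

* `validRaw_eq_true_iff` (`validRaw` decides `RawBP.Valid`), `symNodeRaw_eq`, `symBPRaw_eq`,
  `symFalseRaw_eq` (the symbolic matrix `L` of AIK Lemma 4.15 read off raw nodes is `symBP` of the
  typed program / of the one-node 0-sink), `sizeRaw_eq`, `encodeBDDRaw_eq`
  (`= encodeBDD n₀ (compile n B).2 Fin.val`), `encodeBDDsRaw_eq` (`= encodeBDDs Fin.val n₀ (compileAll n Bs)`),
  `rawOf_toPEA` (the untyped data of DGRV's instance map `PEABPInst.toPEA` is `toPEARaw`);
* the Boolean codes of `PEABP` / `PEDBP` instances are the `CodeFP` tuple codes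
  (`encode_eq_peabpE`, `encode_eq_pedbpE`; codes `nodeE`, `peabpE`, `pedbpE`, `peaE`).

With these, a `CodeFP` program for `toPEARaw` is literally the `∃ f ∈ FP` clause of the Karp
reduction `PEABP ≤ₚ PEA 3` (assembled in `SzkEntropyPeaThreeNotInPSocket.lean`).
Sources: B. Applebaum, Y. Ishai, E. Kushilevitz, SIAM J. Comput. 36 (2006) §4.3 (Lemma 4.15, 4.9);
Z. Dvir, D. Gutfreund, G. N. Rothblum, S. Vadhan, ECCC TR10-160 (2010) Thm 4.6; S. Arora, B. Barak,
*Computational Complexity* (2009) §0.1 (codes of tuples).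
-/

namespace Summit.PneNP.PneNP.Cruxes.PeaThreeNotInP.SocketBP

set_option linter.dupNamespace false -- `Summit.PneNP.PneNP.…`: summit = sub-problem name (D-0017)

open _root_.Computability Finset
open Literature.InformationTheory.Entropy
open Literature.Computability.Complexity Literature.Computability.Complexity.RandPoly
open Literature.Computability.Cryptography (toInput fnList freshBDDs encodeBDDsMap encodeBDDs_fst_eq)
open CodeFP (natE pairE rawE listE)

/-! ### §1 The raw functions are the untyped images of the typed encoding -/

section Bridge

variable {n : ℕ}

/-- `validRaw` decides `RawBP.Valid`. [folklore] -/
theorem validRaw_eq_true_iff (n : ℕ) (B : RawBP) : validRaw n B = true ↔ RawBP.Valid n B := by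
  unfold validRaw RawBP.Valid
  simp only [Bool.and_eq_true, decide_eq_true_eq, List.all_eq_true, List.mem_range]
  refine and_congr_right fun _ => ⟨fun h i => ?_, fun h i hi => ?_⟩
  · have := h i.val i.isLt
    rwa [List.getD_eq_getElem _ _ i.isLt] at this
  · have := h ⟨i, hi⟩
    rwa [List.getD_eq_getElem _ _ hi]

/-- `validRaw` is `false` exactly on invalid programs. [folklore] -/
theorem validRaw_eq_false_iff (n : ℕ) (B : RawBP) : validRaw n B = false ↔ ¬ RawBP.Valid n B := by
  rw [← validRaw_eq_true_iff, Bool.eq_false_iff]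

/-- The raw symbolic node is the symbolic node of the typed node.
[cite: ApplebaumIshaiKushilevitz2006, Lemma 4.15] -/
theorem symNodeRaw_eq (B : RawBP) (h : RawBP.Valid n B) (i : Fin B.length) (c : ℕ) :
    symNodeRaw B[i] B.length c = symNode Fin.val (RawBP.nodeOf n B h i) c := by
  unfold RawBP.nodeOf symNodeRaw symNode
  by_cases h2 : 2 ≤ (B[i]).1
  · rw [dif_pos h2, if_neg (not_lt.2 h2)]
  · rw [dif_neg h2, if_pos (not_le.1 h2)]
    simp only [decide_eq_true_eq]

/-- The raw symbolic matrix is the symbolic matrix `L` of the typed program.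
[cite: ApplebaumIshaiKushilevitz2006, Lemma 4.15] -/
theorem symBPRaw_eq (B : RawBP) (h : RawBP.Valid n B) :
    symBPRaw B = symBP (RawBP.toBDD n B h) Fin.val := by
  funext r c
  unfold symBPRaw symBP
  congr 1
  by_cases hr : r = 0
  · simp only [hr, if_true]
    rfl
  · rw [if_neg hr, if_neg hr]
    by_cases hr' : r ≤ B.length ∧ 0 < r
    · rw [if_pos hr', dif_pos hr']
      have hlt : B.length - r < B.length := by omega
      rw [List.getD_eq_getElem _ _ hlt]
      exact symNodeRaw_eq B h ⟨B.length - r, hlt⟩ c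
    · rw [if_neg hr', dif_neg hr']

/-- The raw symbolic matrix of the one-node 0-sink. [cite: ApplebaumIshaiKushilevitz2006, Lemma 4.15] -/
theorem symFalseRaw_eq (n : ℕ) : symFalseRaw = symBP (RawBP.falseBDD (Fin n)) Fin.val := by
  funext r c
  unfold symFalseRaw symBP
  congr 1
  by_cases hr : r = 0
  · simp only [hr, if_true]
    have : (RawBP.falseBDD (Fin n)).root.val = 0 := rfl
    rw [this]
    by_cases hc : c = 0
    · subst hc; simp
    · rw [if_neg hc, if_neg (by omega)]
  · rw [if_neg hr, if_neg hr]
    by_cases hr' : r ≤ 1 ∧ 0 < r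
    · rw [dif_pos hr']
      have : (RawBP.falseBDD (Fin n)).node ⟨1 - r, by omega⟩ = .leaf false := rfl
      rw [this]
      simp [symNode]
    · rw [dif_neg hr']

/-- `sizeRaw` is the size of the compiled program. [folklore] -/
theorem sizeRaw_eq (n : ℕ) (B : RawBP) : sizeRaw n B = (RawBP.compile n B).1 := by
  unfold sizeRaw RawBP.compile
  by_cases hv : RawBP.Valid n B
  · rw [(validRaw_eq_true_iff n B).2 hv, dif_pos hv]; rfl
  · rw [(validRaw_eq_false_iff n B).2 hv, dif_neg hv]; rfl

/-- **The raw block is the AIK encoding of the compiled program.**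
[cite: ApplebaumIshaiKushilevitz2006, Lemma 4.15] -/
theorem encodeBDDRaw_eq (n₀ n : ℕ) (B : RawBP) :
    encodeBDDRaw n₀ n B = encodeBDD n₀ (RawBP.compile n B).2 Fin.val := by
  unfold encodeBDDRaw RawBP.compile encodeBDD
  by_cases hv : RawBP.Valid n B
  · rw [(validRaw_eq_true_iff n B).2 hv, dif_pos hv, symBPRaw_eq B hv]
    rfl
  · rw [(validRaw_eq_false_iff n B).2 hv, dif_neg hv, symFalseRaw_eq n]
    rfl

/-- **The raw list encoding is the AIK encoding of the compiled programs** (same counter, same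
outputs). [cite: ApplebaumIshaiKushilevitz2006, Lemma 4.9] -/
theorem encodeBDDsRaw_eq (n n₀ : ℕ) (Bs : List RawBP) :
    encodeBDDsRaw n n₀ Bs = encodeBDDs Fin.val n₀ (compileAll n Bs) := by
  induction Bs generalizing n₀ with
  | nil => rfl
  | cons B Bs ih =>
    simp only [encodeBDDsRaw, compileAll, List.map_cons, encodeBDDs]
    rw [sizeRaw_eq, encodeBDDRaw_eq, ih]
    rfl

/-- **The untyped data of the instance map `toPEA` is the raw instance map `toPEARaw`.**
[cite: DvirGutfreundRothblumVadhan2010, Thm 4.6] -/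
theorem rawOf_toPEA (I : PEABPInst) :
    ((PEABPInst.toPEA I).1, natOf (PEABPInst.toPEA I).2.1, (PEABPInst.toPEA I).2.2) = toPEARaw I := by
  have h1 : (encodeBDDsRaw I.1 I.1 I.2.1).1 = I.1 + I.fresh := by
    rw [encodeBDDsRaw_eq]; exact encodeBDDs_fst_eq _
  have h2 : (encodeBDDsRaw I.1 I.1 I.2.1).2 = natOf (PEABPInst.toPEA I).2.1 := by
    rw [encodeBDDsRaw_eq]
    exact (natOf_toFinMap _ _ _).symm
  unfold toPEARaw
  rw [h1, h2, Nat.add_sub_cancel_left]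
  rfl

/-- The `CodeFP` code of raw nodes. [AroraBarak2009, §0.1] -/
abbrev nodeE : ℕ × ℕ × ℕ × ℕ → List Bool := pairE natE (pairE natE (pairE natE natE))

/-- The `CodeFP` code of `PEABP` instances. [AroraBarak2009, §0.1] -/
abbrev peabpE : ℕ × List (List (ℕ × ℕ × ℕ × ℕ)) × ℕ → List Bool :=
  pairE natE (pairE (listE (listE nodeE)) natE)

/-- The `CodeFP` code of `PEDBP` instances. [AroraBarak2009, §0.1] -/
abbrev pedbpE : (ℕ × List (List (ℕ × ℕ × ℕ × ℕ))) × (ℕ × List (List (ℕ × ℕ × ℕ × ℕ))) → List Bool :=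
  pairE (pairE natE (listE (listE nodeE))) (pairE natE (listE (listE nodeE)))

/-- The `CodeFP` code of `PEA` instances (untyped). [AroraBarak2009, §0.1] -/
abbrev peaE : ℕ × List (List (List ℕ)) × ℕ → List Bool :=
  pairE natE (pairE (listE (listE (listE natE))) natE)

/-- The code of a raw program list is the `CodeFP` headed-list code. [AroraBarak2009, §0.1] -/
theorem rawBP_listBool_encode_eq :
    (RawBP.encoding.listBool.encode : List RawBP → List Bool) = listE (listE nodeE) := by
  rw [CodeFP.listE_eq, RawBP.encoding, CodeFP.listE_eq, RawBPNode.encoding, CodeFP.pairE_eq,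
    CodeFP.pairE_eq, CodeFP.pairE_eq, CodeFP.natE_eq]

/-- **The code of a `PEABP` instance is the `CodeFP` tuple code.** [AroraBarak2009, §0.1] -/
theorem encode_eq_peabpE (I : PEABPInst) : PEABPInst.encoding.encode I = peabpE I := by
  have h : (PEABPInst.encoding.encode : PEABPInst → List Bool) = peabpE := by
    rw [PEABPInst.encoding, CodeFP.pairE_eq, CodeFP.pairE_eq, rawBP_listBool_encode_eq,
      CodeFP.natE_eq]
  rw [h]

/-- **The code of a `PEDBP` instance is the `CodeFP` tuple code.** [AroraBarak2009, §0.1] -/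
theorem encode_eq_pedbpE (I : PEDBPInst) : PEDBPInst.encoding.encode I = pedbpE I := by
  have h : (PEDBPInst.encoding.encode : PEDBPInst → List Bool) = pedbpE := by
    rw [PEDBPInst.encoding, CodeFP.pairE_eq, CodeFP.pairE_eq, rawBP_listBool_encode_eq,
      CodeFP.natE_eq]
  rw [h]

end Bridge

end Summit.PneNP.PneNP.Cruxes.PeaThreeNotInP.SocketBP
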